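import Summits.SmoothPoincare4.SmoothPoincare4.Theorems.ConvexBisectionAcyclicBisectionExistsHurwitzMoveModel
import Summits.SmoothPoincare4.SmoothPoincare4.Theorems.ConvexBisectionAcyclicBisectionExistsBeltMonodromyPages
import HarnessLib

/-!
# N1 ▸ `node_N1_move` ▸ (c₁) THE FREE SLICE MOVE: the ALGEBRA OF THE SEAM/BELT DICHOTOMY on one manifold
# (identity dichotomy of a thinned datum; transitivity), tools of the core of design v3
(wave 8, brick of stub `stub_M2geo` = node N1 of NF4 ▸ `node_N1_move_of_pieces (HC1) …` ▸ `HC1` ▸ hypothesis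
`HCORE` of `piece_c1_of_pieces` (`…SliceMoveAssembly.lean`), steps (i) and (vi) of its route; line
`modp-braid-orbits`, crux `ConvexBisection.AcyclicBisectionExists`, item stmt-SmoothPoincare4-10508; worker J5,
lead c5; design v3 `work/design/N1_SliceMove_Design.lean`; registered sub-goal `helper_posMul_trans`)

The core of the free slice move outputs a new multi-attachment datum `D'` of the SAME manifold `X` together
with the **seam/belt dichotomy of `(h', D')` against `(h, D)`** for old directions `d` and new directions `e`:
(O1) a new seam boundary point `D'.jA a'` is an old seam point `D.jA a` on the same `w`-ray
(`w a' ∈ ℝ_{>0} w a`) or an old deep belt point `D.jB k b ∉ range D.jA` with `w a' ∈ ℝ_{>0} d k`;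
(O2) a new deep belt boundary point `D'.jB k' b'` is an old seam point `D.jA a` with `w a ∈ ℝ_{>0} e k'` or an
old deep belt point of a handle `k` with `d k = e k'`.  The core is a composite (thin the tubes, then
re-dig), so it needs the dichotomy to be a CATEGORY on the data of one `X`:
* §1 positive multiples compose (`helper_posMul_trans`, registered) and pin unit directions
  (`eq_of_pos_mul_unit_eq`, H4);
* §2 `thin_dichotomy` — a datum with the same cores, the same `jA` on the common complement, the same range
  of `jA` and the same deep `jB` (the exported trace of `helper_exists_thinData`, p170665) satisfies the
  dichotomy against the original with UNCHANGED directions (H7's `piece_a_dichotomy` without the `refl`);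
  `exists_thin_dichotomy` packages it with `helper_exists_thinData`: step (i) of the core;
* §3 `dichotomy_trans` — dichotomies `(D₁ | D, d → d₁)` and `(D₂ | D₁, d₁ → d₂)` compose to
  `(D₂ | D, d → d₂)` for unit directions (last step of (vi), and the iteration of moves).
Everything is proved; no definitions, no named facts, no `sorry`.  Reference: A. A. Kosinski, *Differential
Manifolds* (1993), VI §6 [Kosinski1993].
-/

noncomputable section

set_option linter.dupNamespace false

open scoped Manifold ContDiff Topology Real
open Set Function

namespace Summit.SmoothPoincare4.SmoothPoincare4.Theorems.AcyclicBisectionExists.ModpBraidOrbits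

open Literature.Topology.FourManifolds Literature.Topology.FourManifolds.LefschetzBase
open Literature.Topology.FourManifolds.HandleAttachingMap

/-! ## §1 Positive multiples -/

/-- **Sub-goal `helper_posMul_trans`** (fully qualified): being a positive real multiple is transitive.
[folklore] -/
theorem helper_posMul_trans : ∀ (u v z : ℂ), (∃ c : ℝ, 0 < c ∧ u = (c : ℂ) * v) → (∃ c : ℝ, 0 < c ∧ v = (c : ℂ) * z) → ∃ c : ℝ, 0 < c ∧ u = (c : ℂ) * z := by
  rintro u v z ⟨c, hc, rfl⟩ ⟨c', hc', rfl⟩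
  exact ⟨c * c', mul_pos hc hc', by push_cast; ring⟩

/-- Being a positive real multiple is symmetric. [folklore] -/
theorem posMul_symm {u v : ℂ} (h : ∃ c : ℝ, 0 < c ∧ u = (c : ℂ) * v) : ∃ c : ℝ, 0 < c ∧ v = (c : ℂ) * u := by
  obtain ⟨c, hc, rfl⟩ := h
  refine ⟨c⁻¹, inv_pos.2 hc, ?_⟩
  have hc0 : (c : ℂ) ≠ 0 := by exact_mod_cast hc.ne'
  push_cast
  rw [← mul_assoc, inv_mul_cancel₀ hc0, one_mul]

/-- Two positive rays through unit vectors that share a point are equal. [folklore] -/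
theorem unit_eq_of_posMul {u : ℂ} {e e' : ℂ} (he : ‖e‖ = 1) (he' : ‖e'‖ = 1)
    (h : ∃ c : ℝ, 0 < c ∧ u = (c : ℂ) * e) (h' : ∃ c : ℝ, 0 < c ∧ u = (c : ℂ) * e') : e = e' := by
  obtain ⟨c, hc, hu⟩ := h
  obtain ⟨c', hc', hu'⟩ := h'
  exact eq_of_pos_mul_unit_eq hc hc' he he' (hu.symm.trans hu')

/-! ## §2 The identity dichotomy of a thinned datum -/

section Thin

variable {g n : ℕ} {h h' : Fin n → HandleAttachingMap 3 2 (Base g)}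
  {X : Type} [TopologicalSpace X] [ChartedSpace (EuclideanHalfSpace 4) X]

/-- **A datum with the same cores, the same `jA` on the common complement, the same range of `jA` and the
same deep `jB` satisfies the seam/belt dichotomy against the original with unchanged directions** (the
trace exported by `helper_exists_thinData`). [cite: Kosinski1993, VI §6] -/
theorem thin_dichotomy (D : MultiAttachmentData h (𝓡∂ 4) X) (D' : MultiAttachmentData h' (𝓡∂ 4) X)
    (d : Fin n → ℂ) (hcore : ∀ k, (h' k).core = (h k).core)
    (hjA : ∀ (a' : ↥(coresComplement h')) (a : ↥(coresComplement h)), (a' : Base g) = a → D'.jA a' = D.jA a)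
    (hr : range D'.jA = range D.jA) (hjB : ∀ k b, D'.jB k b ∉ range D'.jA → D'.jB k b = D.jB k b) :
    (∀ a' : ↥(coresComplement h'), D'.jA a' ∈ (𝓡∂ 4).boundary X →
      (∃ a : ↥(coresComplement h), D'.jA a' = D.jA a ∧
        ∃ c : ℝ, 0 < c ∧ w g (a' : Base g).1 = (c : ℂ) * w g (a : Base g).1) ∨
      (∃ (k : Fin n) (b : ↥(beltPiece 3 2)), D'.jA a' = D.jB k b ∧ D'.jA a' ∉ range D.jA ∧
        ∃ c : ℝ, 0 < c ∧ w g (a' : Base g).1 = (c : ℂ) * d k)) ∧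
    (∀ (k' : Fin n) (b' : ↥(beltPiece 3 2)), D'.jB k' b' ∉ range D'.jA →
      D'.jB k' b' ∈ (𝓡∂ 4).boundary X →
      (∃ a : ↥(coresComplement h), D'.jB k' b' = D.jA a ∧
        ∃ c : ℝ, 0 < c ∧ w g (a : Base g).1 = (c : ℂ) * d k') ∨
      (∃ (k : Fin n) (b : ↥(beltPiece 3 2)), D'.jB k' b' = D.jB k b ∧ D'.jB k' b' ∉ range D.jA ∧
        d k = d k')) := by
  constructor
  · intro a' _
    have ha : (a' : Base g) ∈ coresComplement h := by
      have h2 := a'.2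
      simp only [mem_coresComplement] at h2 ⊢
      intro k; rw [← hcore k]; exact h2 k
    exact Or.inl ⟨⟨a', ha⟩, hjA a' ⟨a', ha⟩ rfl, 1, one_pos, by push_cast; ring⟩
  · intro k' b' hdeep _
    refine Or.inr ⟨k', b', hjB k' b' hdeep, ?_, rfl⟩
    rw [← hr]; exact hdeep

/-- **Step (i) of the core: thin tubes with the identity dichotomy.**  For open sets `U k ⊇ (h k).core`
there are attaching maps `h₁ k` with ranges inside `U k`, the same circles, framings and cores, and a datum
`D₁` of the same `X` satisfying the seam/belt dichotomy against `D` with unchanged directions.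
[cite: Kosinski1993, VI §6] -/
theorem exists_thin_dichotomy [IsManifold (𝓡∂ 4) ∞ X] (D : MultiAttachmentData h (𝓡∂ 4) X)
    (d : Fin n → ℂ) (U : Fin n → Set (Base g)) (hU : ∀ k, IsOpen (U k)) (hcore : ∀ k, (h k).core ⊆ U k) :
    ∃ (h₁ : Fin n → HandleAttachingMap 3 2 (Base g)) (D₁ : MultiAttachmentData h₁ (𝓡∂ 4) X),
      (∀ k, range (h₁ k).toFun ⊆ U k) ∧ (∀ k, (h₁ k).attachingCircle = (h k).attachingCircle) ∧
      (∀ k, (h₁ k).attachingFraming = (h k).attachingFraming) ∧ (∀ k, (h₁ k).core = (h k).core) ∧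
      (∀ a' : ↥(coresComplement h₁), D₁.jA a' ∈ (𝓡∂ 4).boundary X →
        (∃ a : ↥(coresComplement h), D₁.jA a' = D.jA a ∧
          ∃ c : ℝ, 0 < c ∧ w g (a' : Base g).1 = (c : ℂ) * w g (a : Base g).1) ∨
        (∃ (k : Fin n) (b : ↥(beltPiece 3 2)), D₁.jA a' = D.jB k b ∧ D₁.jA a' ∉ range D.jA ∧
          ∃ c : ℝ, 0 < c ∧ w g (a' : Base g).1 = (c : ℂ) * d k)) ∧
      (∀ (k' : Fin n) (b' : ↥(beltPiece 3 2)), D₁.jB k' b' ∉ range D₁.jA →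
        D₁.jB k' b' ∈ (𝓡∂ 4).boundary X →
        (∃ a : ↥(coresComplement h), D₁.jB k' b' = D.jA a ∧
          ∃ c : ℝ, 0 < c ∧ w g (a : Base g).1 = (c : ℂ) * d k') ∨
        (∃ (k : Fin n) (b : ↥(beltPiece 3 2)), D₁.jB k' b' = D.jB k b ∧ D₁.jB k' b' ∉ range D.jA ∧
          d k = d k')) := by
  obtain ⟨h₁, D₁, hrg, hci, hfr, hco, hjA, hr, hjB⟩ := helper_exists_thinData g n h X D U hU hcore
  exact ⟨h₁, D₁, hrg, hci, hfr, hco, thin_dichotomy D D₁ d hco hjA hr hjB⟩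

end Thin

/-! ## §3 Transitivity of the dichotomy -/

section Trans

variable {g n : ℕ} {h h₁ h₂ : Fin n → HandleAttachingMap 3 2 (Base g)}
  {X : Type} [TopologicalSpace X] [ChartedSpace (EuclideanHalfSpace 4) X]

/-- **Seam/belt dichotomies on one manifold compose**: if `(h₁, D₁)` satisfies the dichotomy against
`(h, D)` for directions `d → d₁` and `(h₂, D₂)` against `(h₁, D₁)` for `d₁ → d₂`, then `(h₂, D₂)` satisfies
it against `(h, D)` for `d → d₂` (unit directions: a point on two unit rays pins the directions,
`unit_eq_of_posMul`).  Used to prepend the thinning step and to iterate moves.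
[cite: Kosinski1993, VI §6] -/
theorem dichotomy_trans (D : MultiAttachmentData h (𝓡∂ 4) X) (D₁ : MultiAttachmentData h₁ (𝓡∂ 4) X)
    (D₂ : MultiAttachmentData h₂ (𝓡∂ 4) X) (d d₁ d₂ : Fin n → ℂ) (hd : ∀ k, ‖d k‖ = 1)
    (hd₂ : ∀ k, ‖d₂ k‖ = 1)
    (A1 : ∀ a' : ↥(coresComplement h₁), D₁.jA a' ∈ (𝓡∂ 4).boundary X →
      (∃ a : ↥(coresComplement h), D₁.jA a' = D.jA a ∧
        ∃ c : ℝ, 0 < c ∧ w g (a' : Base g).1 = (c : ℂ) * w g (a : Base g).1) ∨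
      (∃ (k : Fin n) (b : ↥(beltPiece 3 2)), D₁.jA a' = D.jB k b ∧ D₁.jA a' ∉ range D.jA ∧
        ∃ c : ℝ, 0 < c ∧ w g (a' : Base g).1 = (c : ℂ) * d k))
    (A2 : ∀ (k' : Fin n) (b' : ↥(beltPiece 3 2)), D₁.jB k' b' ∉ range D₁.jA →
      D₁.jB k' b' ∈ (𝓡∂ 4).boundary X →
      (∃ a : ↥(coresComplement h), D₁.jB k' b' = D.jA a ∧
        ∃ c : ℝ, 0 < c ∧ w g (a : Base g).1 = (c : ℂ) * d₁ k') ∨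
      (∃ (k : Fin n) (b : ↥(beltPiece 3 2)), D₁.jB k' b' = D.jB k b ∧ D₁.jB k' b' ∉ range D.jA ∧
        d k = d₁ k'))
    (B1 : ∀ a' : ↥(coresComplement h₂), D₂.jA a' ∈ (𝓡∂ 4).boundary X →
      (∃ a : ↥(coresComplement h₁), D₂.jA a' = D₁.jA a ∧
        ∃ c : ℝ, 0 < c ∧ w g (a' : Base g).1 = (c : ℂ) * w g (a : Base g).1) ∨
      (∃ (k : Fin n) (b : ↥(beltPiece 3 2)), D₂.jA a' = D₁.jB k b ∧ D₂.jA a' ∉ range D₁.jA ∧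
        ∃ c : ℝ, 0 < c ∧ w g (a' : Base g).1 = (c : ℂ) * d₁ k))
    (B2 : ∀ (k' : Fin n) (b' : ↥(beltPiece 3 2)), D₂.jB k' b' ∉ range D₂.jA →
      D₂.jB k' b' ∈ (𝓡∂ 4).boundary X →
      (∃ a : ↥(coresComplement h₁), D₂.jB k' b' = D₁.jA a ∧
        ∃ c : ℝ, 0 < c ∧ w g (a : Base g).1 = (c : ℂ) * d₂ k') ∨
      (∃ (k : Fin n) (b : ↥(beltPiece 3 2)), D₂.jB k' b' = D₁.jB k b ∧ D₂.jB k' b' ∉ range D₁.jA ∧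
        d₁ k = d₂ k')) :
    (∀ a' : ↥(coresComplement h₂), D₂.jA a' ∈ (𝓡∂ 4).boundary X →
      (∃ a : ↥(coresComplement h), D₂.jA a' = D.jA a ∧
        ∃ c : ℝ, 0 < c ∧ w g (a' : Base g).1 = (c : ℂ) * w g (a : Base g).1) ∨
      (∃ (k : Fin n) (b : ↥(beltPiece 3 2)), D₂.jA a' = D.jB k b ∧ D₂.jA a' ∉ range D.jA ∧
        ∃ c : ℝ, 0 < c ∧ w g (a' : Base g).1 = (c : ℂ) * d k)) ∧
    (∀ (k' : Fin n) (b' : ↥(beltPiece 3 2)), D₂.jB k' b' ∉ range D₂.jA →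
      D₂.jB k' b' ∈ (𝓡∂ 4).boundary X →
      (∃ a : ↥(coresComplement h), D₂.jB k' b' = D.jA a ∧
        ∃ c : ℝ, 0 < c ∧ w g (a : Base g).1 = (c : ℂ) * d₂ k') ∨
      (∃ (k : Fin n) (b : ↥(beltPiece 3 2)), D₂.jB k' b' = D.jB k b ∧ D₂.jB k' b' ∉ range D.jA ∧
        d k = d₂ k')) := by
  constructor
  · intro a' hb
    rcases B1 a' hb with ⟨a₁, he₁, hray₁⟩ | ⟨k₁, b₁, he₁, hnot₁, hray₁⟩
    · -- through an intermediate seam point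
      have hb₁ : D₁.jA a₁ ∈ (𝓡∂ 4).boundary X := he₁ ▸ hb
      rcases A1 a₁ hb₁ with ⟨a, he, hray⟩ | ⟨k, b, he, hnot, hray⟩
      · exact Or.inl ⟨a, he₁.trans he, helper_posMul_trans _ _ _ hray₁ hray⟩
      · exact Or.inr ⟨k, b, he₁.trans he, he₁ ▸ hnot, helper_posMul_trans _ _ _ hray₁ hray⟩
    · -- through an intermediate deep belt point
      have hb₁ : D₁.jB k₁ b₁ ∈ (𝓡∂ 4).boundary X := he₁ ▸ hb
      have hnot₁' : D₁.jB k₁ b₁ ∉ range D₁.jA := by rwa [he₁] at hnot₁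
      rcases A2 k₁ b₁ hnot₁' hb₁ with ⟨a, he, hray⟩ | ⟨k, b, he, hnot, hdir⟩
      · exact Or.inl ⟨a, he₁.trans he, helper_posMul_trans _ _ _ hray₁ (posMul_symm hray)⟩
      · refine Or.inr ⟨k, b, he₁.trans he, he₁ ▸ hnot, ?_⟩
        rw [hdir]; exact hray₁
  · intro k' b' hdeep hb
    rcases B2 k' b' hdeep hb with ⟨a₁, he₁, hray₁⟩ | ⟨k₁, b₁, he₁, hnot₁, hdir₁⟩
    · have hb₁ : D₁.jA a₁ ∈ (𝓡∂ 4).boundary X := he₁ ▸ hb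
      rcases A1 a₁ hb₁ with ⟨a, he, hray⟩ | ⟨k, b, he, hnot, hray⟩
      · exact Or.inl ⟨a, he₁.trans he, helper_posMul_trans _ _ _ (posMul_symm hray) hray₁⟩
      · exact Or.inr ⟨k, b, he₁.trans he, he₁ ▸ hnot, unit_eq_of_posMul (hd k) (hd₂ k') hray hray₁⟩
    · have hb₁ : D₁.jB k₁ b₁ ∈ (𝓡∂ 4).boundary X := he₁ ▸ hb
      have hnot₁' : D₁.jB k₁ b₁ ∉ range D₁.jA := by rwa [he₁] at hnot₁
      rcases A2 k₁ b₁ hnot₁' hb₁ with ⟨a, he, hray⟩ | ⟨k, b, he, hnot, hdir⟩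
      · exact Or.inl ⟨a, he₁.trans he, hdir₁ ▸ hray⟩
      · exact Or.inr ⟨k, b, he₁.trans he, he₁ ▸ hnot, hdir.trans hdir₁⟩

end Trans

end Summit.SmoothPoincare4.SmoothPoincare4.Theorems.AcyclicBisectionExists.ModpBraidOrbits

end
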